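import Literature.MathematicalPhysics.KineticTheory.TaggedSphereDiffusionCorrector
import HarnessLib

/-!
# Duhamel calculus for the mode amplitude of BGSR's linear Boltzmann equation
(Bodineau–Gallagher–Saint-Raymond, Invent. Math. 203 (2016) = arXiv:1305.3397v2, (1.3), §6.1;
preparatory layer of the bottom-up proof of the named fact
`Literature.MathematicalPhysics.KineticTheory.bgsr_hydrodynamicLimit` of `TaggedSphereDiffusion`)

Three tool results used to show that the mode amplitude `ĝ_n(t, v)` of the collision series
(`TaggedSphereHydrodynamicModes`) solves the velocity-only equation
`∂ₜ ĝ = -(α a_β + i ω) ĝ + α K⁺_β ĝ` pointwise in `v` (the hypothesis bundle `IsModePair` of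
`TaggedSphereModeEnergy`):

* `linearBoltzmannSeries_eq_signed` — the **Duhamel fixed point for signed data** on `T^d`:
  the collision series `φ[f]` of a continuous `|f| ≤ R` satisfies `φ = u₀[f] + 𝒯 φ`
  (from the nonnegative theory of `TaggedLinearBoltzmannSeries`, `φ[f] = φ[f + R] - R`).
* `continuous_carlemanGain_param` — for `G(s, w)` jointly continuous and bounded, the gain
  `s ↦ (K⁺_β G(s, ·))(v) = ∫ k_β(v, u) G(s, v + u) du` is continuous (dominated convergence with
  the integrable Carleman kernel).
* `hasDerivAt_of_duhamel` — **variation of constants**: if `g(t) = e^{-zt} + ∫₀ᵗ e^{-z(t-s)} F(s) ds`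
  for `t ≥ 0` with `F : ℝ → ℂ` continuous, then `g'(t) = -z g(t) + F(t)` for `t > 0`.

## References

* T. Bodineau, I. Gallagher, L. Saint-Raymond, *The Brownian motion as the limit of a
  deterministic system of hard-spheres*, Invent. Math. 203 (2016) 493–553 = arXiv:1305.3397v2,
  (1.3), §6.1.
-/

open MeasureTheory Metric Set Filter Topology ProbabilityTheory
open scoped InnerProductSpace ENNReal NNReal

namespace Literature.MathematicalPhysics.KineticTheory

noncomputable section

open Literature.Analysis.FunctionSpaces (maxwellianBeta maxwellianBeta_pos)
open TaggedSphereDiffusion (collisionFrequency)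

variable {d : Type*} [Fintype d] {β : ℝ}

/-! ## The Duhamel fixed point for signed data on the torus -/

section Signed

/-- Continuity of the torus translation. [folklore] -/
theorem continuous_torus_translate' :
    Continuous fun p : UnitAddTorus d × EuclideanSpace ℝ d => ((Literature.Analysis.FluidPDE.Torus.geometry d)).translate p.1 p.2 := by
  change Continuous fun p : UnitAddTorus d × EuclideanSpace ℝ d => p.1 + Literature.Analysis.FunctionSpaces.Torus.proj p.2
  exact continuous_fst.add (Literature.Analysis.FunctionSpaces.Torus.continuous_proj.comp continuous_snd)

/-- **The Duhamel fixed point for a signed bounded continuous datum** on `T^d`: for continuous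
`|f| ≤ R`, `β > 0`, `α ≥ 0`, the collision series solves `φ[f] = u₀[f] + 𝒯 φ[f]`
(`u₀[f](t) = e^{-α a t⁺} f(x - t⁺ v)`, `𝒯` the gain Duhamel map): `φ[f] = φ[f + R] - R`,
`u₀` is linear, `𝒯 R = R(1 - e^{-α a t⁺})`, and `𝒯` is additive on bounded continuous densities.
[cite: BodineauGallagherSaintRaymondInvent2016, (1.3)] -/
theorem linearBoltzmannSeries_eq_signed (hβ : 0 < β) {α : ℝ} (hα : 0 ≤ α) {f : UnitAddTorus d → ℝ}
    (hf : Continuous f) {R : ℝ} (hR : ∀ x, |f x| ≤ R) (t : ℝ) (x : UnitAddTorus d) (v : EuclideanSpace ℝ d) :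
    linearBoltzmannSeries (Literature.Analysis.FluidPDE.Torus.geometry d) β α (fun x _ => f x) t x v =
      linearBoltzmannTerm (Literature.Analysis.FluidPDE.Torus.geometry d) β α (fun x _ => f x) 0 t x v +
        gainDuhamel (Literature.Analysis.FluidPDE.Torus.geometry d) β α (linearBoltzmannSeries (Literature.Analysis.FluidPDE.Torus.geometry d) β α (fun x _ => f x)) t x v := by
  have hR0 : 0 ≤ R := (abs_nonneg _).trans (hR 0)
  have Df : LinearBoltzmannData (Literature.Analysis.FluidPDE.Torus.geometry d) β α (fun x _ => f x + R) (2 * R) :=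
    linearBoltzmannData_torus (d := d) (ρ₀ := fun x => f x + R) hβ hα (hf.add continuous_const)
      (fun x => by have := (abs_le.1 (hR x)).1; linarith)
      (fun x => by have := (abs_le.1 (hR x)).2; linarith)
  -- the series of `f` through that of `f + R`, as functions
  have hterm : ∀ k, linearBoltzmannTerm (Literature.Analysis.FluidPDE.Torus.geometry d) β α (fun x _ => f x) k = fun t x v =>
      linearBoltzmannTerm (Literature.Analysis.FluidPDE.Torus.geometry d) β α (fun x _ => f x + R) k t x v - linearBoltzmannTerm (Literature.Analysis.FluidPDE.Torus.geometry d) β α (fun _ _ => R) k t x v := by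
    -- this is `linearBoltzmannTerm_eq_sub_of_abs_le` of `TaggedSphereHydrodynamicModes`; reproved locally
    have DR : LinearBoltzmannData (Literature.Analysis.FluidPDE.Torus.geometry d) β α (fun (_ : UnitAddTorus d) (_ : EuclideanSpace ℝ d) => R) R :=
      linearBoltzmannData_torus (d := d) hβ hα continuous_const (fun _ => hR0) (fun _ => le_rfl)
    intro k
    induction k with
    | zero => funext t x v; simp only [linearBoltzmannTerm_zero]; ring
    | succ k ih =>
      funext t x v
      rw [linearBoltzmannTerm_succ, linearBoltzmannTerm_succ, linearBoltzmannTerm_succ, ih]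
      have e1 : (fun t x v => linearBoltzmannTerm (Literature.Analysis.FluidPDE.Torus.geometry d) β α (fun x _ => f x + R) k t x v -
          linearBoltzmannTerm (Literature.Analysis.FluidPDE.Torus.geometry d) β α (fun _ _ => R) k t x v) = fun t x v =>
          linearBoltzmannTerm (Literature.Analysis.FluidPDE.Torus.geometry d) β α (fun x _ => f x + R) k t x v +
            (-1) * linearBoltzmannTerm (Literature.Analysis.FluidPDE.Torus.geometry d) β α (fun _ _ => R) k t x v := by
        funext t x v; ring
      have hcR : Continuous fun p : ℝ × UnitAddTorus d × EuclideanSpace ℝ d =>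
          (-1) * linearBoltzmannTerm (Literature.Analysis.FluidPDE.Torus.geometry d) β α (fun _ _ => R) k p.1 p.2.1 p.2.2 :=
        continuous_const.mul (DR.continuous_linearBoltzmannTerm k)
      have hbR : ∀ t x v, |(-1) * linearBoltzmannTerm (Literature.Analysis.FluidPDE.Torus.geometry d) β α (fun _ _ => R) k t x v| ≤ R :=
        fun t x v => by rw [abs_mul, abs_neg, abs_one, one_mul]; exact DR.abs_linearBoltzmannTerm_le k t x v
      rw [e1, gainDuhamel_add continuous_torus_translate' hβ (Df.continuous_linearBoltzmannTerm k)
        (Df.abs_linearBoltzmannTerm_le k) hcR hbR t x v, gainDuhamel_const_mul]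
      ring
  have hseries : linearBoltzmannSeries (Literature.Analysis.FluidPDE.Torus.geometry d) β α (fun x _ => f x) =
      fun t x v => linearBoltzmannSeries (Literature.Analysis.FluidPDE.Torus.geometry d) β α (fun x _ => f x + R) t x v - R := by
    funext t x v
    have DR : LinearBoltzmannData (Literature.Analysis.FluidPDE.Torus.geometry d) β α (fun (_ : UnitAddTorus d) (_ : EuclideanSpace ℝ d) => R) R :=
      linearBoltzmannData_torus (d := d) hβ hα continuous_const (fun _ => hR0) (fun _ => le_rfl)
    have e : ∀ k, linearBoltzmannTerm (Literature.Analysis.FluidPDE.Torus.geometry d) β α (fun x _ => f x) k t x v =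
        linearBoltzmannTerm (Literature.Analysis.FluidPDE.Torus.geometry d) β α (fun x _ => f x + R) k t x v -
          linearBoltzmannTerm (Literature.Analysis.FluidPDE.Torus.geometry d) β α (fun _ _ => R) k t x v := fun k => by rw [hterm k]
    unfold linearBoltzmannSeries
    rw [tsum_congr e, (Df.summable_linearBoltzmannTerm t x v).tsum_sub (DR.summable_linearBoltzmannTerm t x v)]
    congr 1
    exact linearBoltzmannSeries_const continuous_torus_translate' hβ hα R t x v
  -- the fixed point for `f + R` and for the constant `R`
  have hfix := Df.linearBoltzmannSeries_eq t x v
  have h0 : linearBoltzmannTerm (Literature.Analysis.FluidPDE.Torus.geometry d) β α (fun x _ => f x) 0 t x v =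
      linearBoltzmannTerm (Literature.Analysis.FluidPDE.Torus.geometry d) β α (fun x _ => f x + R) 0 t x v -
        R * Real.exp (-(α * collisionFrequency β v * max t 0)) := by
    rw [hterm 0]
    simp only [linearBoltzmannTerm_zero]
    ring
  -- `𝒯 (φ[f + R] - R) = 𝒯 φ[f + R] - R (1 - e^{-α a t⁺})`
  have hT : gainDuhamel (Literature.Analysis.FluidPDE.Torus.geometry d) β α (linearBoltzmannSeries (Literature.Analysis.FluidPDE.Torus.geometry d) β α (fun x _ => f x)) t x v =
      gainDuhamel (Literature.Analysis.FluidPDE.Torus.geometry d) β α (linearBoltzmannSeries (Literature.Analysis.FluidPDE.Torus.geometry d) β α (fun x _ => f x + R)) t x v -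
        R * (1 - Real.exp (-(α * collisionFrequency β v * max t 0))) := by
    rw [hseries]
    have hadd := gainDuhamel_add (G := (Literature.Analysis.FluidPDE.Torus.geometry d)) (α := α) continuous_torus_translate' hβ
      (ψ₁ := linearBoltzmannSeries (Literature.Analysis.FluidPDE.Torus.geometry d) β α (fun x _ => f x + R)) (ψ₂ := fun _ _ _ => -R)
      Df.continuous_linearBoltzmannSeries Df.abs_linearBoltzmannSeries_le continuous_const
      (C₂ := R) (fun _ _ _ => by rw [abs_neg, abs_of_nonneg hR0]) t x v
    have e1 : (fun t x v => linearBoltzmannSeries (Literature.Analysis.FluidPDE.Torus.geometry d) β α (fun x _ => f x + R) t x v - R) = fun t x v =>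
        linearBoltzmannSeries (Literature.Analysis.FluidPDE.Torus.geometry d) β α (fun x _ => f x + R) t x v + (fun (_ : ℝ) (_ : UnitAddTorus d) (_ : EuclideanSpace ℝ d) => -R) t x v := by
      funext t x v; ring
    rw [e1, hadd, gainDuhamel_const]
    ring
  rw [h0, hT]
  have : linearBoltzmannSeries (Literature.Analysis.FluidPDE.Torus.geometry d) β α (fun x _ => f x) t x v =
      linearBoltzmannSeries (Literature.Analysis.FluidPDE.Torus.geometry d) β α (fun x _ => f x + R) t x v - R := by rw [hseries]
  rw [this, hfix]
  ring

end Signed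

/-! ## Continuity of the gain along a continuous bounded family -/

/-- **Parametric continuity of the Carleman gain**: for `G(s, w)` jointly continuous with
`|G| ≤ B`, `s ↦ (K⁺_β G(s, ·))(v)` is continuous (dominated convergence, the Carleman kernel is
integrable). [folklore] -/
theorem continuous_carlemanGain_param (hd : 2 ≤ Fintype.card d) (hβ : 0 < β)
    {G : ℝ → EuclideanSpace ℝ d → ℝ} (hG : Continuous fun p : ℝ × EuclideanSpace ℝ d => G p.1 p.2)
    {B : ℝ} (hB : ∀ s w, |G s w| ≤ B) (v : EuclideanSpace ℝ d) :
    Continuous fun s => carlemanGain β (G s) v := by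
  unfold carlemanGain
  refine continuous_of_dominated (bound := fun u => B * carlemanKernel β v u) (fun s => ?_) (fun s => ?_)
    ((integrable_carlemanKernel hd hβ v).const_mul B) ?_
  · exact ((measurable_carlemanKernel_right β v).mul
      ((hG.comp (continuous_const.prodMk (continuous_const.add continuous_id))).measurable)).aestronglyMeasurable
  · exact Eventually.of_forall fun u => by
      rw [Real.norm_eq_abs, abs_mul, abs_of_nonneg (carlemanKernel_nonneg β v u), mul_comm B]
      exact mul_le_mul_of_nonneg_left (hB _ _) (carlemanKernel_nonneg β v u)
  · exact Eventually.of_forall fun u =>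
      continuous_const.mul (hG.comp (continuous_id.prodMk continuous_const))

/-! ## Variation of constants -/

/-- **Variation of constants**: if `g(t) = e^{-zt} + ∫₀ᵗ e^{-z(t-s)} F(s) ds` for all `t ≥ 0`, with
`F : ℝ → ℂ` continuous, then `g'(t) = -z g(t) + F(t)` for every `t > 0`. [folklore] -/
theorem hasDerivAt_of_duhamel {z : ℂ} {F g : ℝ → ℂ} (hF : Continuous F)
    (hg : ∀ t, 0 ≤ t → g t = Complex.exp (-z * t) + ∫ s in (0 : ℝ)..t, Complex.exp (-z * (t - s)) * F s)
    {t : ℝ} (ht : 0 < t) :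
    HasDerivAt g (-z * g t + F t) t := by
  -- factored form `g = e^{-zt} (1 + ∫₀ᵗ e^{zs} F(s) ds)` near `t`
  set I : ℝ → ℂ := fun u => ∫ s in (0 : ℝ)..u, Complex.exp (z * s) * F s with hI
  have hfact : ∀ u, 0 ≤ u → g u = Complex.exp (-z * u) * (1 + I u) := by
    intro u hu
    rw [hg u hu, hI, mul_add, mul_one, ← intervalIntegral.integral_const_mul]
    congr 1
    refine intervalIntegral.integral_congr fun s _ => ?_
    rw [← mul_assoc, ← Complex.exp_add]
    congr 1
    congr 1
    ring
  have hIc : Continuous fun s : ℝ => Complex.exp (z * s) * F s := by fun_prop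
  have hI' : HasDerivAt I (Complex.exp (z * t) * F t) t :=
    intervalIntegral.integral_hasDerivAt_right (hIc.intervalIntegrable _ _)
      (hIc.stronglyMeasurableAtFilter _ _) hIc.continuousAt
  have hE' : HasDerivAt (fun u : ℝ => Complex.exp (-z * u)) (Complex.exp (-z * t) * -z) t := by
    have h1 : HasDerivAt (fun u : ℝ => -z * u) (-z) t := by
      simpa using (hasDerivAt_id (t : ℝ)).ofReal_comp.const_mul (-z)
    exact h1.cexp
  have hprod := hE'.mul (hI'.const_add 1)
  have heq : g =ᶠ[𝓝 t] fun u => Complex.exp (-z * u) * (1 + I u) := by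
    filter_upwards [Ioi_mem_nhds ht] with u hu using hfact u (le_of_lt hu)
  refine (hprod.congr_of_eventuallyEq heq).congr_deriv ?_
  rw [hfact t ht.le]
  have : Complex.exp (-z * t) * Complex.exp (z * t) = 1 := by
    rw [← Complex.exp_add]; simp
  linear_combination (F t) * this

end

end Literature.MathematicalPhysics.KineticTheory
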